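import Summits.BirchSwinnertonDyer.Rank1Residual.Supersingular.KobayashiMainConjectureX7BSTWScopeS
import HarnessLib

/-!
# The TWIST SCOPE of the BSTW twist clause in its (def)-VARIANT `S_tw^def` — Burungale–Skinner–Tian–Wan Thm. 10.5's
# second alternative (TeX l.7390–7391 «Each prime dividing N⁻ satisfies (ram) and ν(N⁻) is odd») for the twisting
# field `K = ℚ(√d)` taken as the auxiliary field of §10.3 for `(E₀, p)` (cell `pub/bsd-litref`, sub-dir `bstw24`,
# typer seat `bsd-litref-bstw24-ty` gen 8; ADDITIVE companion of `KobayashiMainConjectureX7BSTWScopeS.lean` (p500588: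
# the STRICT scope `S_tw^aux` = first alternative of l.7459, referee C4 ROUND C4-R3-ADD-6))

HONEST FRAMING (programme BSD-LIT2PART v1 §HONESTY, verbatim): «no tranche here proves BSD; ARM L moves the LITERAL
column of an r ≤ 1 census into the kernel-proved-modulo-named-print column; ARM P changes what "named print" is
worth.» arXiv:2409.01350v2 is an UNREFEREED PREPRINT: it enters ONLY as explicitly labelled OPEN hypotheses
(`def … : Prop`, `[claim: …, status: under-review]`), NEVER as theorems; nothing about any curve is asserted; class X7
stays CONSTRUCTION-SHAPED; bookings are referee A's. Typed ≠ proved ≠ endorsed.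

WHY THIS FILE. Referee C4, ROUND C4-R3-ADD-6 (`pub-bsdpct/REFEREE.md` l.7934), (b): «THE SCOPE OBJECT IS NAMED … the
typer FILES the road-B2 re-built draft … STRICT first alternative only; … the R7 (def)-variant is an AUTHORISED OPTION
only if typed to the print's (def) [L7390–7391] letter with pv's 25 candidates re-checked against it». THE LETTER (TeX
of record 5926f035551c636d, re-read first-hand): §10.3 l.7457–7459 «Pick an imaginary quadratic field L such that (ord)
holds and (D_L, 2N) = 1. Suppose also that either q is inert in L and the primes dividing N/q split, or that (def)
holds.»; Thm. 10.5 l.7389–7391 «Write N = N⁺N⁻ for N⁺ precisely divisible by split primes in L. … (def) Each prime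
dividing N⁻ satisfies (ram) and ν(N⁻) is odd»; (ram) l.7184–7185 «There exists a prime ℓ ∥ N with ρ̄ ramified at ℓ» —
at a multiplicative prime of the semistable `E₀` this is `p ∤ ord_ℓ(Δ_min)`, the tree's `BSTWScope.IsAuxiliaryPrime
W₀ p ℓ` (X6 scope file). Read with `L := K` (road B2, reader 2's sheet 12a33d6b09c94339 §B.2, which spells the (def)
alternative explicitly; reader 1's ADDENDUM-1 16a3b3eea074a1c6 concurring): `N⁻` = the bad primes of `E₀` INERT in `K`,
and (def) says EVERY one of them is (ram) for `p` and they are ODD in number — the strict scope is the case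
`N⁻ = q`. All else of §10.3 is as in the strict file ((ord); `(D_K, 2N) = 1`; (spl)'s 2-clause, Thm. 9.24 l.7263
«if 2 does not split in L, then 2 ∣ N⁻» — a GOOD `2` must split). The printed proof then runs verbatim (Thm. 10.5 under (def) + Prop. 10.7 + Thm. 10.4 (b), unit argument l.7465–7475 with
the one-conjunct reader repair), so on `S_tw^def` the twist clause has the epistemic status of the untwisted clause in
the (def) configuration: `p ≥ 5` PASS-in-cell with the cell repairs (C4-R3 (γ)(ζ)), `p = 3` GAP(line) of record (C4-R3
(β)). NOTE for the record: the untwisted S-tier files (`KobayashiMainConjectureX6BSTWScopeS.lean`) type the witness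
`BSTWScope.HasAuxWitness` in the FIRST alternative only («the wider (def)-variant … is covered by the same reading but
not spelled», X7 strict file l.119–121); `S_tw^def ⊄ HasAuxWitness` as typed, and NO such inclusion is claimed here.
TYPER-SIDE RE-CHECK of pv g6's 25 «(def)» census candidates (read there as «odd number ≥ 3 of inert bad primes, ≥ 1
(ram)») against the letter (`pub/bsd-litref/bstw24/staging/bsd-litref-bstw24-ty/lean-g8/DEF-LETTER-RECHECK.md`
ea2bdaa49f772b18): 21 of 25 satisfy it, 4 fail (`p ∣ ord₂ Δ₀`) — counts pv's to confirm. This file types the predicate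
and the tiers; VERDICT-NEUTRAL; 0 cells move (PRE-tier citability BY NAME on `S_tw^def` is referee A's word).

CONTENTS. § ScopeDef: `BSTWScope.IsAuxiliaryFieldDef` / `BSTWScope.IsAuxiliaryTwistDef` (the predicate and the scope),
strict ⊆ (def) PROVED (`isAuxiliaryFieldDef_of_isAuxiliaryField`, `isAuxiliaryTwistDef_of_isAuxiliaryTwist`), and the
kernel form from DECIDABLE data with a LIST of inert (ram) primes (`isAuxiliaryTwistDef_of_kronecker`). § TierMCDef /
§ TierPPartDef: the four (def)-scoped OPEN binders — the strict file's binders with `IsAuxiliaryTwist` ↦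
`IsAuxiliaryTwistDef` —, printed ⟹ (def)-tier ⟹ strict tier PROVED, the lower-divisibility one-liner, the two
`BSDp` bridges. Outside `S_tw^aux ∪ S_tw^def` nothing changes: road B1, GAP(line) T1 ∧ T2b, typed BY NAME elsewhere.

## References
* [BurungaleSkinnerTianWan2024] arXiv:2409.01350v2 (TeX 5926f035551c636d): Thm. 10.1 (p. 86; l.7315–7323, twist sentence l.7322); Cor. 10.2
  (p. 86; l.7328–7342, twist sentence l.7341); Thm. 10.5 (p. 87; l.7387–7404; (def) l.7390–7391); (ram) l.7184–7185;
  Thm. 9.24 (spl) l.7263; §10.3 proof of Thm. 10.1 (p. 88; l.7454–7479).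
* [Kobayashi2003] Main Conjecture (p. 2); [SkinnerUrban2014] Thm. 2 (p. 3), second bullet ((ram)); [Cox2013] §7.B Thm.
  7.7 (ii), [Marcus2018] Ch. 3 Thm. 25 (decomposition law); [Miller2011LMS] §1, Def. 1.1. Litref record: sheets
  D-AUDIT-bstw24-r2-TWIST.md 12a33d6b09c94339 (§B.2) + ADD-1 5d731181c47ec60d, D-AUDIT-bstw24-r1-TWIST.md f4111aa165ebbd47 +
  ADD-1 16a3b3eea074a1c6; referee C4 ROUND C4-R3-ADD-6 (b)(γ).
-/

set_option autoImplicit false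

noncomputable section

open scoped Classical

open WeierstrassCurve NumberField Literature.NumberTheory.EllipticCurves
  Literature.NumberTheory.EllipticCurves.ModularForms
  Literature.NumberTheory.EllipticCurves.Rank1Residual
  Literature.NumberTheory.EllipticCurves.Rank1Residual.Typed
  Literature.NumberTheory.EllipticCurves.BurungaleSkinnerTianWan2024
  Literature.NumberTheory.EllipticCurves.Kobayashi2003

namespace Summit.BirchSwinnertonDyer.Rank1Residual.Supersingular

/-! ### § ScopeDef — the (def)-variant auxiliary field, the scope `S_tw^def`, strict ⊆ (def), kernel form -/
section ScopeDef

/-- **(def)-variant of the auxiliary-field predicate** (BSTW §10.3 l.7459, second alternative; (def) = Thm. 10.5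
l.7390–7391 «Each prime dividing N⁻ satisfies (ram) and ν(N⁻) is odd», `N⁻` = the bad primes inert in `L`): `L`
imaginary quadratic; (ord) `p` split; `d_L` odd and prime to every bad prime (`(D_L, 2N) = 1`); a GOOD `2` splits
((spl)'s 2-clause, Thm. 9.24 l.7263); every bad prime `ℓ` is SPLIT, or INERT with (ram) (`BSTWScope.IsAuxiliaryPrime W
p ℓ`: `ℓ ≠ p`, multiplicative, `p ∤ ord_ℓ Δ_min`); and the inert bad primes — the prime factors `ℓ` of `N_W` with
one prime of `𝓞 L` above `ℓ` — are ODD in number. "Split"∕"inert" spelled as in `BSTWScope.IsAuxiliaryField`.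
A predicate; nothing asserted. [cite: SkinnerUrban2014, Thm. 2 (p. 3), second bullet (shape of (ram) only; nothing asserted)] -/
def BSTWScope.IsAuxiliaryFieldDef (W : WeierstrassCurve ℚ) [W.IsGloballyMinimal] (p : ℕ) (L : Type) [Field L]
    [NumberField L] : Prop :=
  IsImaginaryQuadratic L ∧
    ((Ideal.span {(p : ℤ)}).primesOver (𝓞 L)).ncard = 2 ∧
    ¬ (2 : ℤ) ∣ NumberField.discr L ∧
    (∀ ℓ : ℕ, (hℓ : ℓ.Prime) →
      (haveI : Fact ℓ.Prime := ⟨hℓ⟩; ¬ W.HasGoodReductionAtPrime ℓ) → ¬ (ℓ : ℤ) ∣ NumberField.discr L) ∧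
    (W.HasGoodReductionAtPrime 2 → ((Ideal.span {(2 : ℤ)}).primesOver (𝓞 L)).ncard = 2) ∧
    (∀ ℓ : ℕ, (hℓ : ℓ.Prime) →
      (haveI : Fact ℓ.Prime := ⟨hℓ⟩; ¬ W.HasGoodReductionAtPrime ℓ) →
        ((Ideal.span {(ℓ : ℤ)}).primesOver (𝓞 L)).ncard = 2 ∨
          (((Ideal.span {(ℓ : ℤ)}).primesOver (𝓞 L)).ncard = 1 ∧
            (haveI : Fact ℓ.Prime := ⟨hℓ⟩; BSTWScope.IsAuxiliaryPrime W p ℓ))) ∧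
    Odd ((W.conductorNorm ℤ).primeFactors.filter
      (fun ℓ : ℕ => ((Ideal.span {(ℓ : ℤ)}).primesOver (𝓞 L)).ncard = 1)).card

/-- **The (def)-variant twist scope `S_tw^def`**: the quadratic field `K` of discriminant `d` is an admissible
auxiliary field of §10.3 for `(W₀, p)` in the sense of (def) (`BSTWScope.IsAuxiliaryFieldDef W₀ p K`). A predicate;
nothing asserted. [cite: SkinnerUrban2014, Thm. 2 (p. 3), second bullet (shape of (ram) only; nothing asserted)] -/
def BSTWScope.IsAuxiliaryTwistDef (W₀ : WeierstrassCurve ℚ) [W₀.IsGloballyMinimal] (p : ℕ) (d : ℤ) : Prop :=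
  ∃ (K : Type) (_ : Field K) (_ : NumberField K),
    Module.finrank ℚ K = 2 ∧ NumberField.discr K = d ∧ BSTWScope.IsAuxiliaryFieldDef W₀ p K

variable {W : WeierstrassCurve ℚ} [W.IsElliptic] [W.IsGloballyMinimal] {p : ℕ}

omit [W.IsGloballyMinimal] in
/-- The filter of `N_W`'s prime factors used in `IsAuxiliaryFieldDef` (the inert bad primes) EQUALS a finset `Q`
once every `q ∈ Q` is bad with one prime of `𝓞 L` above it and every bad prime outside `Q` has two. [folklore] -/
theorem BSTWScope.inertFilter_eq {L : Type} [Field L] [NumberField L] (Q : Finset ℕ)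
    (hQ : ∀ q ∈ Q, ∃ hq : q.Prime, (haveI : Fact q.Prime := ⟨hq⟩; ¬ W.HasGoodReductionAtPrime q) ∧
      ((Ideal.span {(q : ℤ)}).primesOver (𝓞 L)).ncard = 1)
    (hsplit : ∀ ℓ : ℕ, (hℓ : ℓ.Prime) → ℓ ∉ Q →
      (haveI : Fact ℓ.Prime := ⟨hℓ⟩; ¬ W.HasGoodReductionAtPrime ℓ) →
        ((Ideal.span {(ℓ : ℤ)}).primesOver (𝓞 L)).ncard = 2) :
    (W.conductorNorm ℤ).primeFactors.filter
        (fun ℓ : ℕ => ((Ideal.span {(ℓ : ℤ)}).primesOver (𝓞 L)).ncard = 1) = Q := by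
  ext ℓ
  simp only [Finset.mem_filter, Nat.mem_primeFactors]
  constructor
  · rintro ⟨⟨hℓ, hdvd, -⟩, h1⟩
    by_contra hℓQ
    haveI : Fact ℓ.Prime := ⟨hℓ⟩
    have h2 := hsplit ℓ hℓ hℓQ ((W.dvd_conductorNorm_iff_not_hasGoodReductionAtPrime ℓ).mp hdvd)
    omega
  · intro hℓQ
    obtain ⟨hℓ, hbad, h1⟩ := hQ ℓ hℓQ
    haveI : Fact ℓ.Prime := ⟨hℓ⟩
    exact ⟨⟨hℓ, (W.dvd_conductorNorm_iff_not_hasGoodReductionAtPrime ℓ).mpr hbad,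
      (W.conductorNorm_pos_holds).ne'⟩, h1⟩

/-- **Strict ⊆ (def) for fields**: an auxiliary pair `(q, L)` of the first alternative (`BSTWScope.IsAuxiliaryPrime W
p q ∧ BSTWScope.IsAuxiliaryField W p q L`) is a (def)-auxiliary field — its inert bad primes are `{q}`. [folklore] -/
theorem BSTWScope.isAuxiliaryFieldDef_of_isAuxiliaryField (q : ℕ) [Fact q.Prime] (L : Type) [Field L]
    [NumberField L] (haux : BSTWScope.IsAuxiliaryPrime W p q) (hL : BSTWScope.IsAuxiliaryField W p q L) :
    BSTWScope.IsAuxiliaryFieldDef W p L := by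
  obtain ⟨him, hp, hq, hsplit, hodd, hcop, htwo⟩ := hL
  have hqbad : ¬ W.HasGoodReductionAtPrime q :=
    WeierstrassCurve.HasMultiplicativeReduction.not_hasGoodReduction (R := ℤ_[q]) haux.2.1
  refine ⟨him, hp, hodd, hcop, htwo, fun ℓ hℓ hbad => ?_, ?_⟩
  · by_cases hℓq : ℓ = q
    · subst hℓq; exact Or.inr ⟨hq, haux⟩
    · exact Or.inl (hsplit ℓ hℓ hℓq hbad)
  · rw [BSTWScope.inertFilter_eq {q} (fun ℓ hℓ => by
        rw [Finset.mem_singleton] at hℓ; subst hℓ; exact ⟨Fact.out, hqbad, hq⟩)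
        (fun ℓ hℓ hℓq hbad => hsplit ℓ hℓ (by rwa [Finset.mem_singleton] at hℓq) hbad), Finset.card_singleton]
    exact odd_one

/-- **`S_tw^aux ⊆ S_tw^def`**: the strict twist scope lies inside the (def)-variant scope. [folklore] -/
theorem BSTWScope.isAuxiliaryTwistDef_of_isAuxiliaryTwist (W₀ : WeierstrassCurve ℚ) [W₀.IsElliptic]
    [W₀.IsGloballyMinimal] (p : ℕ) {d : ℤ} (h : BSTWScope.IsAuxiliaryTwist W₀ p d) :
    BSTWScope.IsAuxiliaryTwistDef W₀ p d := by
  obtain ⟨q, hq, K, hF, hN, h2, hdisc, haux, hfield⟩ := h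
  exact ⟨K, hF, hN, h2, hdisc, BSTWScope.isAuxiliaryFieldDef_of_isAuxiliaryField q K haux hfield⟩

open Literature.NumberTheory.QuadraticFields in
/-- **The (def)-variant twist scope from DECIDABLE data.** For a globally minimal `W₀`, an odd prime `p`, a natural
number `D` with `−D` an odd negative fundamental discriminant, and a duplicate-free LIST `Q` of ODD length of (ram)
primes (`BSTWScope.IsAuxiliaryPrime W₀ p q`) INERT in `ℚ(√−D)` (`(−D/q) = −1`, resp. `−D ≡ 5 (mod 8)` for `q = 2`):
if `(−D/p) = 1`, no bad prime divides `D`, every bad prime outside `Q` splits (`(−D/ℓ) = 1`, resp. `−D ≡ 1 (mod 8)`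
at `ℓ = 2`) and `−D ≡ 1 (mod 8)` when `2` is good, then `(W₀, p, −D) ∈ S_tw^def`. Decomposition law as in
`BSTWScope.isAuxiliaryTwist_of_kronecker`. [cite: Cox2013, §7.B Thm. 7.7(ii)] [cite: Marcus2018, Ch. 3 Thm. 25 (decomposition law at 2)] -/
theorem BSTWScope.isAuxiliaryTwistDef_of_kronecker (W₀ : WeierstrassCurve ℚ) [W₀.IsElliptic] [W₀.IsGloballyMinimal]
    (p : ℕ) [Fact p.Prime] (hp2 : p ≠ 2) (D : ℕ)
    (hfund : (-(D : ℤ)) % 4 = 1 ∧ Squarefree (-(D : ℤ)) ∧ (-(D : ℤ)) ≠ 1)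
    (hsp : jacobiSym (-(D : ℤ)) p = 1) (Q : List ℕ) (hQnd : Q.Nodup) (hQodd : Odd Q.length)
    (hQ : ∀ q ∈ Q, ∃ hq : q.Prime, (haveI : Fact q.Prime := ⟨hq⟩; BSTWScope.IsAuxiliaryPrime W₀ p q) ∧
      (q = 2 → (-(D : ℤ)) % 8 = 5) ∧ (q ≠ 2 → jacobiSym (-(D : ℤ)) q = -1))
    (hbadD : ∀ ℓ : ℕ, (hℓ : ℓ.Prime) →
      (haveI : Fact ℓ.Prime := ⟨hℓ⟩; ¬ W₀.HasGoodReductionAtPrime ℓ) → ¬ (ℓ : ℤ) ∣ (D : ℤ))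
    (hbad : ∀ ℓ : ℕ, (hℓ : ℓ.Prime) → ℓ ∉ Q →
      (haveI : Fact ℓ.Prime := ⟨hℓ⟩; ¬ W₀.HasGoodReductionAtPrime ℓ) →
        (ℓ = 2 → (-(D : ℤ)) % 8 = 1) ∧ (ℓ ≠ 2 → jacobiSym (-(D : ℤ)) ℓ = 1))
    (htwo : W₀.HasGoodReductionAtPrime 2 → (-(D : ℤ)) % 8 = 1) :
    BSTWScope.IsAuxiliaryTwistDef W₀ p (-(D : ℤ)) := by
  obtain ⟨L, _instF, _instN, h2, hdisc⟩ := Quadratic.exists_numberField_discr_eq (D := -(D : ℤ)) (Or.inl hfund)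
  have hneg : NumberField.discr L < 0 := by rw [hdisc]; omega
  -- decomposition law at the listed inert primes and at the other bad primes
  have hinert : ∀ q ∈ Q, ∃ hq : q.Prime, (haveI : Fact q.Prime := ⟨hq⟩; ¬ W₀.HasGoodReductionAtPrime q) ∧
      ((Ideal.span {(q : ℤ)}).primesOver (𝓞 L)).ncard = 1 := by
    intro q hqQ
    obtain ⟨hq, haux, hin⟩ := hQ q hqQ
    haveI : Fact q.Prime := ⟨hq⟩
    refine ⟨hq, WeierstrassCurve.HasMultiplicativeReduction.not_hasGoodReduction (R := ℤ_[q]) haux.2.1, ?_⟩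
    by_cases hq2 : q = 2
    · subst hq2
      simpa using Quadratic.ncard_primesOver_two_eq_one_of_discr_mod_eight h2 (by rw [hdisc]; exact hin.1 rfl)
    · exact BSTWScope.ncard_primesOver_eq_one_of_jacobiSym_eq_neg_one h2 hq (by rw [hdisc]; exact hin.2 hq2)
  have hsplit : ∀ ℓ : ℕ, (hℓ : ℓ.Prime) → ℓ ∉ Q →
      (haveI : Fact ℓ.Prime := ⟨hℓ⟩; ¬ W₀.HasGoodReductionAtPrime ℓ) →
        ((Ideal.span {(ℓ : ℤ)}).primesOver (𝓞 L)).ncard = 2 := by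
    intro ℓ hℓ hℓQ hbadℓ
    by_cases hℓ2 : ℓ = 2
    · subst hℓ2
      simpa using (Quadratic.ncard_primesOver_two_eq_two_iff h2).mpr (by rw [hdisc]; exact (hbad 2 hℓ hℓQ hbadℓ).1 rfl)
    · exact (Quadratic.ncard_primesOver_eq_two_iff_jacobiSym h2 hℓ hℓ2).mpr
        (by rw [hdisc]; exact (hbad ℓ hℓ hℓQ hbadℓ).2 hℓ2)
  refine ⟨L, _instF, _instN, h2, hdisc, ?_, ?_, ?_, ?_, ?_, ?_, ?_⟩
  · exact (isImaginaryQuadratic_iff_discr_neg).mpr ⟨h2, hneg⟩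
  · exact (Quadratic.ncard_primesOver_eq_two_iff_jacobiSym h2 Fact.out hp2).mpr (by rw [hdisc]; exact hsp)
  · rw [hdisc]; omega
  · intro ℓ hℓ hbadℓ
    rw [hdisc, Int.dvd_neg]
    exact hbadD ℓ hℓ hbadℓ
  · intro hgood2
    simpa using (Quadratic.ncard_primesOver_two_eq_two_iff h2).mpr (by rw [hdisc]; exact htwo hgood2)
  · intro ℓ hℓ hbadℓ
    by_cases hℓQ : ℓ ∈ Q
    · obtain ⟨_, haux, -⟩ := hQ ℓ hℓQ
      obtain ⟨-, -, h1⟩ := hinert ℓ hℓQ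
      exact Or.inr ⟨h1, haux⟩
    · exact Or.inl (hsplit ℓ hℓ hℓQ hbadℓ)
  · rw [BSTWScope.inertFilter_eq Q.toFinset (fun q hq => hinert q (List.mem_toFinset.mp hq))
        (fun ℓ hℓ hℓQ hbad => hsplit ℓ hℓ (fun h => hℓQ (List.mem_toFinset.mpr h)) hbad),
      List.toFinset_card_of_nodup hQnd]
    exact hQodd

end ScopeDef

variable (W₀ W : WeierstrassCurve ℚ) [W₀.IsElliptic] [W₀.IsGloballyMinimal] [W.IsElliptic]
  [W.IsGloballyMinimal] (p : ℕ) [Fact p.Prime]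

/-! ### § TierMCDef — the two `S_tw^def`-scoped tiers at MAIN-CONJECTURE level (body wording, Thm. 10.1 l.7322) -/
section TierMCDef

/-- **OPEN BINDER — the `p ≥ 5` TIER of the TWIST CLAUSE of Burungale–Skinner–Tian–Wan Thm. 10.1 (p. 86; twist
sentence l.7322), BODY wording, ON THE (def)-VARIANT TWIST SCOPE `S_tw^def`.** Exactly the strict file's
`BurungaleSkinnerTianWan2024_thm101_twist_scopedS_OPEN` (hypotheses of `thm101_twist_signedMainStatement_OPEN`, `p ≥ 5`,
conclusion `KobayashiMainConjecture W p ε`) with the scope conjunct `BSTWScope.IsAuxiliaryTwist W₀ p d` REPLACED by the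
wider `BSTWScope.IsAuxiliaryTwistDef W₀ p d` ((def), l.7390–7391). Weaker-or-equal to the printed binder
(`thm101_twist_scopedSDef_OPEN_of_thm101_twist_OPEN`), stronger-or-equal to the strict tier
(`thm101_twist_scopedS_OPEN_of_scopedSDef_OPEN`); referee C4 C4-R3-ADD-6 (b): authorised option, typed to the letter.
UNREFEREED PREPRINT: NEVER cite this `Prop` as a theorem; take it as an explicit hypothesis. Nothing asserted.
[claim: BurungaleSkinnerTianWan2024, status: under-review] [cite: Kobayashi2003, Conjecture (Main Conjecture) (p. 2) (shape only)] -/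
def BurungaleSkinnerTianWan2024_thm101_twist_scopedSDef_OPEN : Prop :=
  ∀ (W₀ W : WeierstrassCurve ℚ) [W₀.IsElliptic] [W₀.IsGloballyMinimal] [W.IsElliptic]
    [W.IsGloballyMinimal] (p : ℕ) [Fact p.Prime] (d : ℤ) (C : VariableChange ℚ),
    5 ≤ p → Semistable W₀ → W₀.HasGoodReductionAtPrime p → W₀.frobeniusTrace p = 0 →
    Squarefree d → d ≠ 1 →
    (∀ (q : ℕ) [Fact q.Prime], RamifiedInQuadratic d q → q ≠ p ∧ ¬ q ∣ W₀.conductorNorm ℤ) →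
    C • W = W₀.quadraticTwist (d : ℚ) →
    BSTWScope.IsAuxiliaryTwistDef W₀ p d →
      ∀ ε : ℤˣ, KobayashiMainConjecture W p ε

/-- **OPEN BINDER — the `p = 3` TIER of the TWIST CLAUSE of Thm. 10.1, BODY wording, ON `S_tw^def`.** As
`…_thm101_twist_scopedSDef_OPEN` with `5 ≤ p` ↦ `p = 3` (`a₃(E₀) = 0` = `W₀.frobeniusTrace p = 0`); rests at 3 on the
`p = 3` wall of record ([SV-S-Ohta]; C4-R3 (β)), imported unchanged by road B2. Weaker-or-equal to print
(`thm101_twist_scopedAtThreeSDef_OPEN_of_thm101_twist_OPEN`), stronger-or-equal to the strict tier. UNREFEREED PREPRINT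
resting at 3 on a further preprint: NEVER cite this `Prop` as a theorem; take it as an explicit hypothesis. Nothing
asserted. [claim: BurungaleSkinnerTianWan2024, status: under-review] [cite: Kobayashi2003, Conjecture (Main Conjecture) (p. 2) (shape only)] -/
def BurungaleSkinnerTianWan2024_thm101_twist_scopedAtThreeSDef_OPEN : Prop :=
  ∀ (W₀ W : WeierstrassCurve ℚ) [W₀.IsElliptic] [W₀.IsGloballyMinimal] [W.IsElliptic]
    [W.IsGloballyMinimal] (p : ℕ) [Fact p.Prime] (d : ℤ) (C : VariableChange ℚ),
    p = 3 → Semistable W₀ → W₀.HasGoodReductionAtPrime p → W₀.frobeniusTrace p = 0 →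
    Squarefree d → d ≠ 1 →
    (∀ (q : ℕ) [Fact q.Prime], RamifiedInQuadratic d q → q ≠ p ∧ ¬ q ∣ W₀.conductorNorm ℤ) →
    C • W = W₀.quadraticTwist (d : ℚ) →
    BSTWScope.IsAuxiliaryTwistDef W₀ p d →
      ∀ ε : ℤˣ, KobayashiMainConjecture W p ε

/-- Printed ⟹ (def)-tier at `p ≥ 5`. [claim: BurungaleSkinnerTianWan2024, status: under-review] -/
theorem thm101_twist_scopedSDef_OPEN_of_thm101_twist_OPEN (h : thm101_twist_signedMainStatement_OPEN) :
    BurungaleSkinnerTianWan2024_thm101_twist_scopedSDef_OPEN := by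
  intro W₀ W _ _ _ _ p _ d C h5 hsst hgood hap hd hd1 hram hC _ ε
  exact kobayashiMainConjecture_of_signedCharIdealEq (h W₀ W p d C (by omega) hsst hgood hap hd hd1 hram hC ε)

/-- Printed ⟹ (def)-tier at `p = 3`. [claim: BurungaleSkinnerTianWan2024, status: under-review] -/
theorem thm101_twist_scopedAtThreeSDef_OPEN_of_thm101_twist_OPEN (h : thm101_twist_signedMainStatement_OPEN) :
    BurungaleSkinnerTianWan2024_thm101_twist_scopedAtThreeSDef_OPEN := by
  intro W₀ W _ _ _ _ p _ d C h3 hsst hgood hap hd hd1 hram hC _ ε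
  exact kobayashiMainConjecture_of_signedCharIdealEq (h W₀ W p d C (by omega) hsst hgood hap hd hd1 hram hC ε)

/-- (def)-tier ⟹ strict tier at `p ≥ 5` (`S_tw^aux ⊆ S_tw^def`). [claim: BurungaleSkinnerTianWan2024, status: under-review] -/
theorem thm101_twist_scopedS_OPEN_of_scopedSDef_OPEN (h : BurungaleSkinnerTianWan2024_thm101_twist_scopedSDef_OPEN) :
    BurungaleSkinnerTianWan2024_thm101_twist_scopedS_OPEN :=
  fun W₀ W _ _ _ _ p _ d C h5 hsst hgood hap hd hd1 hram hC htw =>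
    h W₀ W p d C h5 hsst hgood hap hd hd1 hram hC (BSTWScope.isAuxiliaryTwistDef_of_isAuxiliaryTwist W₀ p htw)

/-- (def)-tier ⟹ strict tier at `p = 3`. [claim: BurungaleSkinnerTianWan2024, status: under-review] -/
theorem thm101_twist_scopedAtThreeS_OPEN_of_scopedAtThreeSDef_OPEN
    (h : BurungaleSkinnerTianWan2024_thm101_twist_scopedAtThreeSDef_OPEN) :
    BurungaleSkinnerTianWan2024_thm101_twist_scopedAtThreeS_OPEN :=
  fun W₀ W _ _ _ _ p _ d C h3 hsst hgood hap hd hd1 hram hC htw =>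
    h W₀ W p d C h3 hsst hgood hap hd hd1 hram hC (BSTWScope.isAuxiliaryTwistDef_of_isAuxiliaryTwist W₀ p htw)

/-- The `p ≥ 5` (def)-tier at a (def)-scoped twist `(W, p)` delivers `KobayashiLowerDivisibility W p ε`; the
rank-`0` road to `BSDp W p` from PUBLISHED descents is then `X7.bsdp_of_kobayashiLowerDivisibility_of_surj_of_analyticRank_eq_zero`
exactly as in the strict file's `X7.bsdp_of_thm101_twist_scopedS_OPEN_of_analyticRank_eq_zero` (not re-spelled here).
[claim: BurungaleSkinnerTianWan2024, status: under-review] -/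
theorem kobayashiLowerDivisibility_of_thm101_twist_scopedSDef_OPEN
    (hBSTW : BurungaleSkinnerTianWan2024_thm101_twist_scopedSDef_OPEN) {d : ℤ} {C : VariableChange ℚ}
    (hp5 : 5 ≤ p) (hsst : Semistable W₀) (hgood : W₀.HasGoodReductionAtPrime p) (hap₀ : W₀.frobeniusTrace p = 0)
    (hd : Squarefree d) (hd1 : d ≠ 1)
    (hram : ∀ (q : ℕ) [Fact q.Prime], RamifiedInQuadratic d q → q ≠ p ∧ ¬ q ∣ W₀.conductorNorm ℤ)
    (hC : C • W = W₀.quadraticTwist (d : ℚ)) (htw : BSTWScope.IsAuxiliaryTwistDef W₀ p d) (ε : ℤˣ) :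
    KobayashiLowerDivisibility W p ε :=
  kobayashiLowerDivisibility_of_mainConjecture (hBSTW W₀ W p d C hp5 hsst hgood hap₀ hd hd1 hram hC htw ε)

end TierMCDef

/-! ### § TierPPartDef — the two `S_tw^def`-scoped tiers at `p`-PART level (body wording, Cor. 10.2 l.7341) -/
section TierPPartDef

/-- **OPEN BINDER — the `p ≥ 5` TIER of the TWIST CLAUSE of Burungale–Skinner–Tian–Wan Cor. 10.2 (p. 86; twist
sentence l.7341), BODY wording, ON `S_tw^def`.** Exactly the strict file's `…_cor102_twist_scopedS_OPEN` (hypotheses of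
`cor102_twist_pPart_OPEN`, `p ≥ 5`, analytic rank `≤ 1` ⇒ the `p`-part print shape) with `BSTWScope.IsAuxiliaryTwist`
REPLACED by `BSTWScope.IsAuxiliaryTwistDef`. Weaker-or-equal to print (`cor102_twist_scopedSDef_OPEN_of_cor102_twist_OPEN`),
stronger-or-equal to the strict tier (`cor102_twist_scopedS_OPEN_of_scopedSDef_OPEN`). UNREFEREED PREPRINT: NEVER cite
this `Prop` as a theorem; take it as an explicit hypothesis. Nothing asserted. [claim: BurungaleSkinnerTianWan2024, status: under-review]
[cite: Miller2011LMS, §1 and Def. 1.1 (shape of the conclusion only; nothing asserted)] -/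
def BurungaleSkinnerTianWan2024_cor102_twist_scopedSDef_OPEN : Prop :=
  ∀ (W₀ W : WeierstrassCurve ℚ) [W₀.IsElliptic] [W₀.IsGloballyMinimal] [W.IsElliptic]
    [W.IsGloballyMinimal] (p : ℕ) [Fact p.Prime] (d : ℤ) (C : VariableChange ℚ),
    5 ≤ p → Semistable W₀ → W₀.HasGoodReductionAtPrime p → W₀.frobeniusTrace p = 0 →
    Squarefree d → d ≠ 1 →
    (∀ (q : ℕ) [Fact q.Prime], RamifiedInQuadratic d q → q ≠ p ∧ ¬ q ∣ W₀.conductorNorm ℤ) →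
    C • W = W₀.quadraticTwist (d : ℚ) →
    BSTWScope.IsAuxiliaryTwistDef W₀ p d →
    W.analyticRank ≤ 1 →
      W.mordellWeilRank = W.analyticRank ∧ Finite (AddCommGroup.primaryComponent W.sha p) ∧
      ∃ r : ℚ, W.leadingLCoeff / ((W.realPeriodRat * W.regulator : ℝ) : ℂ) = (r : ℂ) ∧
        padicValRat p r = (padicValNat p W.shaOrder : ℤ) + padicValNat p W.tamagawaProduct

/-- **OPEN BINDER — the `p = 3` TIER of the TWIST CLAUSE of Cor. 10.2, BODY wording, ON `S_tw^def`.** As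
`…_cor102_twist_scopedSDef_OPEN` with `5 ≤ p` ↦ `p = 3`; rests at 3 on the `p = 3` wall of record ([SV-S-Ohta]; C4-R3
(β)). Weaker-or-equal to print, stronger-or-equal to the strict tier. UNREFEREED PREPRINT resting at 3 on a further
preprint: NEVER cite this `Prop` as a theorem; take it as an explicit hypothesis. Nothing asserted. [claim: BurungaleSkinnerTianWan2024, status: under-review]
[cite: Miller2011LMS, §1 and Def. 1.1 (shape of the conclusion only; nothing asserted)] -/
def BurungaleSkinnerTianWan2024_cor102_twist_scopedAtThreeSDef_OPEN : Prop :=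
  ∀ (W₀ W : WeierstrassCurve ℚ) [W₀.IsElliptic] [W₀.IsGloballyMinimal] [W.IsElliptic]
    [W.IsGloballyMinimal] (p : ℕ) [Fact p.Prime] (d : ℤ) (C : VariableChange ℚ),
    p = 3 → Semistable W₀ → W₀.HasGoodReductionAtPrime p → W₀.frobeniusTrace p = 0 →
    Squarefree d → d ≠ 1 →
    (∀ (q : ℕ) [Fact q.Prime], RamifiedInQuadratic d q → q ≠ p ∧ ¬ q ∣ W₀.conductorNorm ℤ) →
    C • W = W₀.quadraticTwist (d : ℚ) →
    BSTWScope.IsAuxiliaryTwistDef W₀ p d →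
    W.analyticRank ≤ 1 →
      W.mordellWeilRank = W.analyticRank ∧ Finite (AddCommGroup.primaryComponent W.sha p) ∧
      ∃ r : ℚ, W.leadingLCoeff / ((W.realPeriodRat * W.regulator : ℝ) : ℂ) = (r : ℂ) ∧
        padicValRat p r = (padicValNat p W.shaOrder : ℤ) + padicValNat p W.tamagawaProduct

/-- Printed ⟹ (def)-tier at `p ≥ 5`. [claim: BurungaleSkinnerTianWan2024, status: under-review] -/
theorem cor102_twist_scopedSDef_OPEN_of_cor102_twist_OPEN (h : cor102_twist_pPart_OPEN) :
    BurungaleSkinnerTianWan2024_cor102_twist_scopedSDef_OPEN :=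
  fun W₀ W _ _ _ _ p _ d C h5 hsst hgood hap hd hd1 hram hC _ hr =>
    h W₀ W p d C (by omega) hsst hgood hap hd hd1 hram hC hr

/-- Printed ⟹ (def)-tier at `p = 3`. [claim: BurungaleSkinnerTianWan2024, status: under-review] -/
theorem cor102_twist_scopedAtThreeSDef_OPEN_of_cor102_twist_OPEN (h : cor102_twist_pPart_OPEN) :
    BurungaleSkinnerTianWan2024_cor102_twist_scopedAtThreeSDef_OPEN :=
  fun W₀ W _ _ _ _ p _ d C h3 hsst hgood hap hd hd1 hram hC _ hr =>
    h W₀ W p d C (by omega) hsst hgood hap hd hd1 hram hC hr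

/-- (def)-tier ⟹ strict tier at `p ≥ 5`. [claim: BurungaleSkinnerTianWan2024, status: under-review] -/
theorem cor102_twist_scopedS_OPEN_of_scopedSDef_OPEN (h : BurungaleSkinnerTianWan2024_cor102_twist_scopedSDef_OPEN) :
    BurungaleSkinnerTianWan2024_cor102_twist_scopedS_OPEN :=
  fun W₀ W _ _ _ _ p _ d C h5 hsst hgood hap hd hd1 hram hC htw hr =>
    h W₀ W p d C h5 hsst hgood hap hd hd1 hram hC (BSTWScope.isAuxiliaryTwistDef_of_isAuxiliaryTwist W₀ p htw) hr

/-- (def)-tier ⟹ strict tier at `p = 3`. [claim: BurungaleSkinnerTianWan2024, status: under-review] -/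
theorem cor102_twist_scopedAtThreeS_OPEN_of_scopedAtThreeSDef_OPEN
    (h : BurungaleSkinnerTianWan2024_cor102_twist_scopedAtThreeSDef_OPEN) :
    BurungaleSkinnerTianWan2024_cor102_twist_scopedAtThreeS_OPEN :=
  fun W₀ W _ _ _ _ p _ d C h3 hsst hgood hap hd hd1 hram hC htw hr =>
    h W₀ W p d C h3 hsst hgood hap hd hd1 hram hC (BSTWScope.isAuxiliaryTwistDef_of_isAuxiliaryTwist W₀ p htw) hr

/-- **Bridge (CONDITIONAL), `p ≥ 5` (def)-tier** (twin of `bsdp_of_cor102_twist_scopedS_OPEN`): granted the tier, at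
every (def)-scoped twist `W` with `p ≥ 5`, `E^K[p]` irreducible and analytic rank `≤ 1`: Miller's `BSD(W, p)` via
`bsdp_of_padicVal_printShape` (GZK by name). Closes nothing.
[claim: BurungaleSkinnerTianWan2024, status: under-review] [cite: Miller2011LMS, §1 and Def. 1.1] -/
theorem bsdp_of_cor102_twist_scopedSDef_OPEN (hBSTW_OPEN : BurungaleSkinnerTianWan2024_cor102_twist_scopedSDef_OPEN)
    (hGZK : rank_eq_analyticRank_of_analyticRank_le_one) {d : ℤ} {C : VariableChange ℚ}
    (hp5 : 5 ≤ p) (hsst : Semistable W₀) (hgood : W₀.HasGoodReductionAtPrime p) (hap : W₀.frobeniusTrace p = 0)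
    (hd : Squarefree d) (hd1 : d ≠ 1)
    (hram : ∀ (q : ℕ) [Fact q.Prime], RamifiedInQuadratic d q → q ≠ p ∧ ¬ q ∣ W₀.conductorNorm ℤ)
    (hC : C • W = W₀.quadraticTwist (d : ℚ)) (htw : BSTWScope.IsAuxiliaryTwistDef W₀ p d) (hirr : Irr W p)
    (hr : W.analyticRank ≤ 1) : BSDp W p :=
  bsdp_of_padicVal_printShape W p hGZK hr hirr
    (hBSTW_OPEN W₀ W p d C hp5 hsst hgood hap hd hd1 hram hC htw hr).2.2

/-- **Bridge (CONDITIONAL), `p = 3` (def)-tier** (twin of `bsdp_of_cor102_twist_scopedAtThreeS_OPEN`). Closes nothing.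
[claim: BurungaleSkinnerTianWan2024, status: under-review] [cite: Miller2011LMS, §1 and Def. 1.1] -/
theorem bsdp_of_cor102_twist_scopedAtThreeSDef_OPEN
    (hBSTW_OPEN : BurungaleSkinnerTianWan2024_cor102_twist_scopedAtThreeSDef_OPEN)
    (hGZK : rank_eq_analyticRank_of_analyticRank_le_one) {d : ℤ} {C : VariableChange ℚ}
    (hp3 : p = 3) (hsst : Semistable W₀) (hgood : W₀.HasGoodReductionAtPrime p) (hap : W₀.frobeniusTrace p = 0)
    (hd : Squarefree d) (hd1 : d ≠ 1)
    (hram : ∀ (q : ℕ) [Fact q.Prime], RamifiedInQuadratic d q → q ≠ p ∧ ¬ q ∣ W₀.conductorNorm ℤ)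
    (hC : C • W = W₀.quadraticTwist (d : ℚ)) (htw : BSTWScope.IsAuxiliaryTwistDef W₀ p d) (hirr : Irr W p)
    (hr : W.analyticRank ≤ 1) : BSDp W p :=
  bsdp_of_padicVal_printShape W p hGZK hr hirr
    (hBSTW_OPEN W₀ W p d C hp3 hsst hgood hap hd hd1 hram hC htw hr).2.2

end TierPPartDef

end Summit.BirchSwinnertonDyer.Rank1Residual.Supersingular

end
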